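import Summits.CriticalPhenomena.PercolationContinuityZ3.Theorems.Transplant.FKConnectivityAllQForestTwoSeparation
import Summits.CriticalPhenomena.PercolationContinuityZ3.Theorems.Transplant.FKConnectivityAllQCountReweightedTrees
import HarnessLib

/-!
# Forest exchange across an arbitrary vertex separator (the separator calculus, configuration level)

builds on p205010 (kernel theorem, internal audit signed; external expert review pending).  No definitions, no named facts, no sorries;
standard axioms.

The configuration-level input of the general separator calculus for the square-free adjacent forest node
`FK.AdjForestRayleighNoSqOn` (memo bschramm/FROM-fk-1-g19-ADVERSARIAL.md §2f, §2h; gen 20).  Set-up: a vertex set `X` (one side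
together with the separator) whose configurations `a` have all their pairs on `X`, and "outside" configurations `ξ, ξ'` touching `X` only
at the RIM `W ⊆ X` (an endpoint in `X` of a pair of `ξ` lies in `W`).  The TRACE of `ξ` on `W` is the reachability relation of `⟨ξ⟩`
restricted to `W`.
* `reachable_sup_of_trace` — if the trace of `ξ` on `W` is contained in that of `ξ'`, then `⟨a⟩ ∨ ⟨ξ⟩`-reachability between points of `X`
  implies `⟨a⟩ ∨ ⟨ξ'⟩`-reachability (walk surgery: every maximal excursion through `ξ` runs rim to rim, `…RandomClusterRimWiring`'s
  argument with the wiring `K_W` replaced by `⟨ξ'⟩`).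
* `clusterCount_union_exchange` — if `ξ, ξ'` have the SAME trace on `W`: `k(a ∪ ξ) + k(ξ') = k(ξ) + k(a ∪ ξ')`, i.e. `k(a ∪ ξ) - k(ξ)`
  depends on `ξ` only through its trace (induction on `a`: a new pair of `a` merges two clusters on the left iff on the right).
* **`isForestCfg_union_exchange`** — if `U ∪ Z ∈ Fo`, `Z' ∈ Fo`, `Z, Z'` touch `X` only at `W` with the same trace, `U` on `X`, `U ∩ Z' = ∅`:
  then `U ∪ Z' ∈ Fo`.  A side glued onto a forest sees only the trace: this is the exchange step behind every separator equality of the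
  node (cut vertex p323201, two-separation p323770/p328146, triangle p328618/p329067, and the general theorem of
  `…ForestAdjacentSeparatorTransfer`).
[cite: Grimmett2006, §4.2 Lemma (4.13); §1.5 (p. 13); §3.8 (pp. 61–62)]
-/

noncomputable section

namespace Summit.CriticalPhenomena.PercolationContinuityZ3.Theorems

namespace FK

open Set SimpleGraph Literature.Probability.LatticeModels Literature.Probability.Percolation
open scoped Classical

section Exchange

variable {V : Type*}

/-- **An outside excursion runs rim to rim, so it can be re-routed through any configuration with a larger trace.**  Let the pairs
of `a` lie on `X`, let every endpoint in `X` of a pair of `ξ` lie in the rim `W`, and let `⟨ξ⟩`-joined rim points be `⟨ξ'⟩`-joined.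
Then two points of `X` joined in `⟨a⟩ ∨ ⟨ξ⟩` are joined in `⟨a⟩ ∨ ⟨ξ'⟩`. [cite: Grimmett2006, §4.2 Lemma (4.13)] -/
theorem reachable_sup_of_trace {a ξ ξ' : Set (Sym2 V)} {W X : Set V}
    (haX : ∀ e ∈ a, ∀ x ∈ e, x ∈ X) (hξ : ∀ e ∈ ξ, ∀ x ∈ e, x ∈ X → x ∈ W)
    (hW : ∀ x ∈ W, ∀ y ∈ W, (fromEdgeSet ξ).Reachable x y → (fromEdgeSet ξ').Reachable x y)
    {u v : V} (hu : u ∈ X) (hv : v ∈ X) (h : (fromEdgeSet a ⊔ fromEdgeSet ξ).Reachable u v) :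
    (fromEdgeSet a ⊔ fromEdgeSet ξ').Reachable u v := by
  obtain ⟨p⟩ := h
  have hKW : ∀ {s t : V}, s ∈ W → t ∈ W → (fromEdgeSet ξ).Reachable s t →
      (fromEdgeSet a ⊔ fromEdgeSet ξ').Reachable s t :=
    fun hs ht hst => (hW _ hs _ ht hst).mono le_sup_right
  -- invariant along a walk towards a vertex of `X`
  suffices H : ∀ {x y : V} (_ : (fromEdgeSet a ⊔ fromEdgeSet ξ).Walk x y), y ∈ X →
      (x ∈ X → (fromEdgeSet a ⊔ fromEdgeSet ξ').Reachable x y) ∧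
      (x ∉ X → ∃ w ∈ W, (fromEdgeSet ξ).Reachable x w ∧ (fromEdgeSet a ⊔ fromEdgeSet ξ').Reachable w y) from
    (H p hv).1 hu
  intro x y q
  induction q with
  | nil => exact fun hy => ⟨fun _ => Reachable.refl _, fun hx => absurd hy hx⟩
  | @cons x x₁ z hxx₁ q ih =>
    intro hz
    have ih := ih hz
    rw [sup_adj] at hxx₁
    rcases hxx₁ with hA | hΞ
    · -- an inside pair: both endpoints in `X`
      have hmem := ((fromEdgeSet_adj _).1 hA).1
      have hx : x ∈ X := haX _ hmem x (Sym2.mem_mk_left x x₁)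
      have hx₁ : x₁ ∈ X := haX _ hmem x₁ (Sym2.mem_mk_right x x₁)
      refine ⟨fun _ => ?_, fun hx' => absurd hx hx'⟩
      have h1 : (fromEdgeSet a ⊔ fromEdgeSet ξ').Adj x x₁ := Or.inl hA
      exact h1.reachable.trans (ih.1 hx₁)
    · -- an outside pair: its endpoints in `X` are rim points
      have hmem := ((fromEdgeSet_adj _).1 hΞ).1
      have hxW : x ∈ X → x ∈ W := hξ _ hmem x (Sym2.mem_mk_left x x₁)
      have hx₁W : x₁ ∈ X → x₁ ∈ W := hξ _ hmem x₁ (Sym2.mem_mk_right x x₁)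
      have hξxx₁ : (fromEdgeSet ξ).Reachable x x₁ := hΞ.reachable
      by_cases hx₁ : x₁ ∈ X
      · have ih1 := ih.1 hx₁
        exact ⟨fun hx => (hKW (hxW hx) (hx₁W hx₁) hξxx₁).trans ih1, fun _ => ⟨x₁, hx₁W hx₁, hξxx₁, ih1⟩⟩
      · obtain ⟨w, hw, hx₁w, hwv⟩ := ih.2 hx₁
        exact ⟨fun hx => (hKW (hxW hx) hw (hξxx₁.trans hx₁w)).trans hwv,
          fun _ => ⟨w, hw, hξxx₁.trans hx₁w, hwv⟩⟩

/-- With equal traces the two reachability relations agree on `X`. [cite: Grimmett2006, §4.2 Lemma (4.13)] -/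
theorem reachable_sup_iff_of_trace {a ξ ξ' : Set (Sym2 V)} {W X : Set V}
    (haX : ∀ e ∈ a, ∀ x ∈ e, x ∈ X) (hξ : ∀ e ∈ ξ, ∀ x ∈ e, x ∈ X → x ∈ W) (hξ' : ∀ e ∈ ξ', ∀ x ∈ e, x ∈ X → x ∈ W)
    (hW : ∀ x ∈ W, ∀ y ∈ W, (fromEdgeSet ξ).Reachable x y ↔ (fromEdgeSet ξ').Reachable x y)
    {u v : V} (hu : u ∈ X) (hv : v ∈ X) :
    (fromEdgeSet a ⊔ fromEdgeSet ξ).Reachable u v ↔ (fromEdgeSet a ⊔ fromEdgeSet ξ').Reachable u v :=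
  ⟨reachable_sup_of_trace haX hξ (fun x hx y hy => (hW x hx y hy).1) hu hv,
    reachable_sup_of_trace haX hξ' (fun x hx y hy => (hW x hx y hy).2) hu hv⟩

variable [Fintype V]

/-- **Cluster counts see only the trace.**  For inside pairs `a` on `X` and outside configurations `ξ, ξ'` touching `X` only at the
rim `W` with the same trace on `W`: `k(a ∪ ξ) + k(ξ') = k(ξ) + k(a ∪ ξ')` (induction on `a`: a new inside pair merges two clusters of
`⟨a⟩ ∨ ⟨ξ⟩` iff it merges two clusters of `⟨a⟩ ∨ ⟨ξ'⟩`, `reachable_sup_iff_of_trace`). [cite: Grimmett2006, §4.2 Lemma (4.13)] -/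
theorem clusterCount_union_exchange (a : Finset (Sym2 V)) {ξ ξ' : Set (Sym2 V)} {W X : Set V}
    (haX : ∀ e ∈ a, ∀ x ∈ e, x ∈ X) (hξ : ∀ e ∈ ξ, ∀ x ∈ e, x ∈ X → x ∈ W) (hξ' : ∀ e ∈ ξ', ∀ x ∈ e, x ∈ X → x ∈ W)
    (hW : ∀ x ∈ W, ∀ y ∈ W, (fromEdgeSet ξ).Reachable x y ↔ (fromEdgeSet ξ').Reachable x y) :
    clusterCount ((↑a : Set (Sym2 V)) ∪ ξ) ∅ + clusterCount ξ' ∅ =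
      clusterCount ξ ∅ + clusterCount ((↑a : Set (Sym2 V)) ∪ ξ') ∅ := by
  classical
  induction a using Finset.induction_on with
  | empty => simp [clusterCount, openGraph]
  | insert e a hea ih =>
    have haX' : ∀ e ∈ a, ∀ x ∈ e, x ∈ X := fun e' he' => haX e' (Finset.mem_insert_of_mem he')
    have ih' := ih haX'
    induction e using Sym2.ind with
    | h u v =>
      have hu : u ∈ X := haX _ (Finset.mem_insert_self _ _) u (Sym2.mem_mk_left u v)
      have hv : v ∈ X := haX _ (Finset.mem_insert_self _ _) v (Sym2.mem_mk_right u v)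
      have hins : ∀ η : Set (Sym2 V), fromEdgeSet ((↑(insert s(u, v) a) : Set (Sym2 V)) ∪ η) ⊔ wired (∅ : Set V) =
          (fromEdgeSet (↑a : Set (Sym2 V)) ⊔ fromEdgeSet η) ⊔ edge u v := by
        intro η
        rw [wired_empty, sup_bot_eq, Finset.coe_insert, Set.insert_union, Set.insert_eq,
          fromEdgeSet_union, fromEdgeSet_union, sup_comm]
        rfl
      have h0 : ∀ η : Set (Sym2 V), fromEdgeSet ((↑a : Set (Sym2 V)) ∪ η) ⊔ wired (∅ : Set V) =
          fromEdgeSet (↑a : Set (Sym2 V)) ⊔ fromEdgeSet η := by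
        intro η
        rw [wired_empty, sup_bot_eq, fromEdgeSet_union]
      unfold clusterCount openGraph at ih' ⊢
      rw [hins ξ, hins ξ']
      rw [h0 ξ, h0 ξ'] at ih'
      set K₁ : SimpleGraph V := fromEdgeSet (↑a : Set (Sym2 V)) ⊔ fromEdgeSet ξ with hK₁
      set K₂ : SimpleGraph V := fromEdgeSet (↑a : Set (Sym2 V)) ⊔ fromEdgeSet ξ' with hK₂
      have hiff : K₁.Reachable u v ↔ K₂.Reachable u v :=
        reachable_sup_iff_of_trace (fun e' he' => haX' e' (Finset.mem_coe.1 he')) hξ hξ' hW hu hv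
      by_cases huv : K₁.Reachable u v
      · rw [card_connectedComponent_sup_edge_of_reachable K₁ huv,
          card_connectedComponent_sup_edge_of_reachable K₂ (hiff.1 huv)]
        exact ih'
      · have huv' : ¬K₂.Reachable u v := fun h => huv (hiff.2 h)
        have l1 := card_connectedComponent_sup_edge_lt K₁ huv
        have l1' := card_connectedComponent_le_sup_edge_add_one K₁ u v
        have l2 := card_connectedComponent_sup_edge_lt K₂ huv'
        have l2' := card_connectedComponent_le_sup_edge_add_one K₂ u v
        omega

/-- The same with sets: `k(U ∪ Z) + k(Z') = k(Z) + k(U ∪ Z')` for `U` on `X` and `Z, Z'` touching `X` only at `W` with equal traces.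
[cite: Grimmett2006, §4.2 Lemma (4.13)] -/
theorem clusterCount_union_exchange' {U Z Z' : BondConfig V} {W X : Set V}
    (hU : ∀ e ∈ U, ∀ x ∈ e, x ∈ X) (hZ : ∀ e ∈ Z, ∀ x ∈ e, x ∈ X → x ∈ W) (hZ' : ∀ e ∈ Z', ∀ x ∈ e, x ∈ X → x ∈ W)
    (hW : ∀ x ∈ W, ∀ y ∈ W, (openGraph Z).Reachable x y ↔ (openGraph Z').Reachable x y) :
    clusterCount (U ∪ Z) ∅ + clusterCount Z' ∅ = clusterCount Z ∅ + clusterCount (U ∪ Z') ∅ := by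
  have hUf : ∀ e ∈ (Set.toFinite U).toFinset, ∀ x ∈ e, x ∈ X := fun e he x hx =>
    hU e ((Set.Finite.mem_toFinset _).1 he) x hx
  have k := clusterCount_union_exchange (Set.toFinite U).toFinset (W := W) (X := X) hUf hZ hZ' hW
  rwa [Set.Finite.coe_toFinset] at k

/-- **Forest exchange across a separator.**  If `U ∪ Z ∈ Fo` with `U` on `X`, `Z, Z'` touching `X` only at the rim `W` with the same
trace on `W`, `Z' ∈ Fo` and `U ∩ Z' = ∅`, then `U ∪ Z' ∈ Fo`: a side glued onto a forest sees only the forest's trace on the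
separator (`Fo ↔ |ω| + k(ω) = |V|` and `clusterCount_union_exchange`). [cite: Grimmett2006, §1.5 (p. 13); §3.8 (pp. 61–62); §4.2 Lemma (4.13)] -/
theorem isForestCfg_union_exchange {U Z Z' : BondConfig V} {W X : Set V}
    (hU : ∀ e ∈ U, ∀ x ∈ e, x ∈ X) (hZ : ∀ e ∈ Z, ∀ x ∈ e, x ∈ X → x ∈ W) (hZ' : ∀ e ∈ Z', ∀ x ∈ e, x ∈ X → x ∈ W)
    (hW : ∀ x ∈ W, ∀ y ∈ W, (openGraph Z).Reachable x y ↔ (openGraph Z').Reachable x y)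
    (hUZ : Disjoint U Z) (hUZ' : Disjoint U Z') (hF : IsForestCfg (U ∪ Z)) (hF' : IsForestCfg Z') :
    IsForestCfg (U ∪ Z') := by
  have hk := clusterCount_union_exchange' hU hZ hZ' hW
  have hZF : IsForestCfg Z := isForestCfg_of_subset hF subset_union_right
  have hcard : (U ∪ Z).ncard = U.ncard + Z.ncard := ncard_union_eq hUZ (toFinite _) (toFinite _)
  have hcard' : (U ∪ Z').ncard = U.ncard + Z'.ncard := ncard_union_eq hUZ' (toFinite _) (toFinite _)
  rw [isForestCfg_iff_ncard_add] at hF hF' hZF ⊢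
  rw [hcard] at hF
  rw [hcard']
  omega

end Exchange

end FK

end Summit.CriticalPhenomena.PercolationContinuityZ3.Theorems

end
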